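import Literature.Barriers.BirchSwinnertonDyer.RankNotSumOfLocalInvariantsF5NormDescentK241Proofs
import Literature.NumberTheory.NumberFields.TableAlgebraLiftA
import HarnessLib

/-!
# Barrier (BirchSwinnertonDyer), rank mod `5`: the quintic Gaussian periods of conductor `2651` as tensors

Towards the four conductor-`2651` quintic descents inside `F₅ ⊂ ℚ(ζ₂₆₅₁)` (T. Dokchitser–
V. Dokchitser, J. Number Theory 131 (2011), proof of Thm. 2; the named fact
`DokchitserDokchitser2011_normDescent_480a1_quintic2651`): the generators of the four "mixed" quintic
subfields. `ℚ(ζ₂₆₅₁) = ℚ(ζ₁₁) ⊗ ℚ(ζ₂₄₁)`, and the Gaussian period of an index-`5` subgroup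
`H_j ⊂ (ℤ/2651)ˣ` (`j = 1, …, 4`) is the TENSOR
**`θK_j = Σ_{a ∈ ℤ/5} η11_a · θ241_{j a}`** of the five conjugate periods `η11_a = ζ₁₁^{2ᵃ} + ζ₁₁^{-2ᵃ}`
of `ℚ(ζ₁₁)⁺` and the five conjugate quintic periods `θ241_b` of conductor `241`
(`RankNotSumOfLocalInvariantsF5NormDescentK241Proofs.lean`). This file proves, with SMALL kernel
computations only:

* the period tables `spec11T`, `spec241T` (`TableSpec 5`, `1 = -Σ e`) and that `η11`, `θ241c` are
  systems for them in any `2651`-st cyclotomic field `K` (`isSystem11`: reflection modulo `X¹¹ - 1`;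
  `isSystem241`: the tree's `isPeriodSystem_gauss`);
* in the nested table algebra `A = TAlg spec11T (TAlg spec241T ℤ)` (`= ℤ[η11] ⊗ ℤ[θ241]`, `25`-dim.)
  the elements `p_j = Σ_a e_a ⊗ e_{j a}` satisfy `f_j(p_j) = 0` (`decide`, `f_j` the defining
  polynomial of `CyclicQuinticField2651K_j.lean`), whence **`f_j(θK_j) = 0`** in `K` through the
  homomorphism `A → K` (`TableSpec.liftA ∘ TAlg.map (TableSpec.lift)`);
* the Galois action: `g ∈ Gal(K/ℚ)`, `g ζ = ζᶜ`, shifts `η11_a ↦ η11_{a + s(c)}`, `θ241_b ↦ θ241_{b + t(c)}`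
  (`s`, `t : (ℤ/2651)ˣ → ℤ/5`, explicit tables checked by `decide`), so `g θK_j = θK_j` whenever
  `t(c) = j s(c)` (`apply_θK_eq`), and `θK_j ∈ F₅`.

## References

* T. Dokchitser, V. Dokchitser, *A note on the Mordell–Weil rank modulo `n`*, J. Number Theory 131
  (2011) 1833–1839: proof of Thm. 2. [DokchitserDokchitser2011RankModN]
* C. F. Gauss, *Disquisitiones Arithmeticae* (1801), art. 343–358 (periods). [folklore]
-/

noncomputable section

open scoped NumberField

open NumberField IntermediateField Finset

namespace Literature.Barriers.BirchSwinnertonDyer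

namespace DokchitserDokchitser2011

open Literature.NumberTheory.NumberFields Literature.NumberTheory.NumberFields.GaussianPeriod

/-! ### The two period tables -/

/-- **The period table of `ℚ(ζ₁₁)⁺`** on the basis `η_a = ζ^{2ᵃ} + ζ^{-2ᵃ}` (`a < 5`), with
`1 = -Σ η_a`. [folklore] -/
def spec11T : TableSpec 5 where
  T := fun a b c => ((![![![-2, -1, -2, -2, -2], ![1, 0, 0, 1, 0], ![0, 0, 0, 1, 1], ![0, 1, 1, 0, 0], ![0, 0, 1, 0, 1]], ![![1, 0, 0, 1, 0], ![-2, -2, -1, -2, -2], ![0, 1, 0, 0, 1], ![1, 0, 0, 0, 1], ![0, 0, 1, 1, 0]], ![![0, 0, 0, 1, 1], ![0, 1, 0, 0, 1], ![-2, -2, -2, -1, -2], ![1, 0, 1, 0, 0], ![1, 1, 0, 0, 0]], ![![0, 1, 1, 0, 0], ![1, 0, 0, 0, 1], ![1, 0, 1, 0, 0], ![-2, -2, -2, -2, -1], ![0, 1, 0, 1, 0]], ![![0, 0, 1, 0, 1], ![0, 0, 1, 1, 0], ![1, 1, 0, 0, 0], ![0, 1, 0, 1, 0], ![-1, -2, -2,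 -2, -2]]] : Fin 5 → Fin 5 → Fin 5 → ℤ) a b c)
  one := fun _ => -1

/-- **The quintic period table of conductor `241`** (the tree's `PeriodRing241`, constants rewritten
with `1 = -Σ θ_b`). [folklore] -/
def spec241T : TableSpec 5 where
  T := fun a b c => ((![![![-37, -38, -36, -40, -42], ![10, 6, 12, 8, 12], ![12, 12, 8, 8, 8], ![8, 8, 8, 12, 12], ![6, 12, 8, 12, 10]], ![![10, 6, 12, 8, 12], ![-42, -37, -38, -36, -40], ![12, 10, 6, 12, 8], ![8, 12, 12, 8, 8], ![12, 8, 8, 8, 12]], ![![12, 12, 8, 8, 8], ![12, 10, 6, 12, 8], ![-40, -42, -37, -38, -36], ![8, 12, 10, 6, 12], ![8, 8, 12, 12, 8]], ![![8, 8, 8, 12, 12], ![8, 12, 12, 8, 8], ![8, 12, 10, 6, 12], ![-36, -40, -42, -37, -38], ![12, 8, 12, 10, 6]], ![![6, 12, 8, 12, 10], ![12, 8, 8, 8, 12], ![8, 8, 12, 12, 8], ![12, 8, 12, 10, 6], ![-38, -36, -40, -42, -37]]] : Fin 5 → Fin 5 → Fin 5 → ℤ) a b c)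
  one := fun _ => -1

/-- `spec11T` is a commutative ring table (kernel check). [folklore] -/
instance spec11T_isRing : Fact spec11T.IsRing := ⟨by decide +kernel⟩

/-- `spec241T` is a commutative ring table (kernel check). [folklore] -/
instance spec241T_isRing : Fact spec241T.IsRing := ⟨by decide +kernel⟩

/-! ### The tensor elements and their equations (kernel) -/

/-- `ℤ[θ241]` as a table algebra. [folklore] -/
abbrev B241 : Type := TAlg spec241T ℤ

/-- **`A = ℤ[η11] ⊗ ℤ[θ241]`** as the nested table algebra. [folklore] -/
abbrev A25 : Type := TAlg spec11T B241

/-- **`p_j = Σ_a e_a ⊗ e_{j a}`.** [folklore] -/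
def pT (j : ℕ) : A25 := ⟨fun a => TAlg.basis (⟨j * (a : ℕ) % 5, Nat.mod_lt _ (by norm_num)⟩ : Fin 5)⟩

set_option maxRecDepth 100000 in
set_option maxHeartbeats 0 in
/-- `f₁(p₁) = 0` in `A` (kernel computation). [folklore] -/
theorem pT_rel_1 : pT 1 ^ 5 - pT 1 ^ 4 - 1060 * pT 1 ^ 3 + 8165 * pT 1 ^ 2 + 42925 * pT 1 - 351649 = 0 := by decide +kernel

set_option maxRecDepth 100000 in
set_option maxHeartbeats 0 in
/-- `f₂(p₂) = 0` in `A`. [folklore] -/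
theorem pT_rel_2 : pT 2 ^ 5 - pT 2 ^ 4 - 1060 * pT 2 ^ 3 - 18345 * pT 2 ^ 2 - 105531 * pT 2 - 192589 = 0 := by decide +kernel

set_option maxRecDepth 100000 in
set_option maxHeartbeats 0 in
/-- `f₃(p₃) = 0` in `A`. [folklore] -/
theorem pT_rel_3 : pT 3 ^ 5 - pT 3 ^ 4 - 1060 * pT 3 ^ 3 - 7741 * pT 3 ^ 2 + 106549 * pT 3 + 125531 = 0 := by decide +kernel

set_option maxRecDepth 100000 in
set_option maxHeartbeats 0 in
/-- `f₄(p₄) = 0` in `A`. [folklore] -/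
theorem pT_rel_4 : pT 4 ^ 5 - pT 4 ^ 4 - 1060 * pT 4 ^ 3 + 18769 * pT 4 ^ 2 - 105531 * pT 4 + 178551 = 0 := by decide +kernel

/-! ### The conjugate periods in a cyclotomic field -/

variable (K : Type) [Field K] [NumberField K] [IsCyclotomicExtension {2651} ℚ K]

/-- The exponents `2ᵃ mod 11`: `1, 2, 4, 8, 5`. [folklore] -/
def ex11 : Fin 5 → ℕ := ![1, 2, 4, 8, 5]

/-- **The conjugate periods of `ℚ(ζ₁₁)⁺`**: `η11 a = ζ₁₁^{2ᵃ} + ζ₁₁^{11 - 2ᵃ}`. [folklore] -/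
def η11 (a : Fin 5) : K := ζ11 K ^ ex11 a + ζ11 K ^ (11 - ex11 a)

/-- `η11 0 = θ11`. [folklore] -/
theorem η11_zero : η11 K 0 = θ11 K := by
  rw [η11, θ11, show ex11 0 = 1 from rfl, pow_one]
  congr 1
  symm
  exact inv_eq_of_mul_eq_one_right (by rw [← pow_succ', show 11 - 1 + 1 = 11 from rfl, ζ11_pow_eleven])

/-- **The conjugate quintic periods of conductor `241`.** [folklore] -/
def θ241c (b : Fin 5) : K := evalCyc (ω241 K) (ind241 b)

/-- `θ241c 0 = θ241`. [folklore] -/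
theorem θ241c_zero : θ241c K 0 = θ241 K := rfl

/-! ### The `11`-periods form a system (reflection modulo `X¹¹ - 1`) -/

/-- Indicator lists of `{2ᵃ, -2ᵃ}` modulo `11`. [folklore] -/
def ind11 (a : Fin 5) : List ℕ := (List.range 11).map fun k => if k = ex11 a ∨ k = 11 - ex11 a then 1 else 0

/-- `ind11 0 * ind11 0`. [folklore] -/
theorem ind11_check_00 : mulCyc (ind11 0) (ind11 0) = addL (ind11 1) (2 :: List.replicate 10 0) := by decide +kernel

/-- `ind11 0 * ind11 1` (cyclic convolution modulo `11`). [folklore] -/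
theorem ind11_check_01 : mulCyc (ind11 0) (ind11 1) = addL (ind11 3) (ind11 0) := by decide +kernel

/-- `ind11 0 * ind11 2` (cyclic convolution modulo `11`). [folklore] -/
theorem ind11_check_02 : mulCyc (ind11 0) (ind11 2) = addL (ind11 4) (ind11 3) := by decide +kernel

/-- `ind11 0 * ind11 3` (cyclic convolution modulo `11`). [folklore] -/
theorem ind11_check_03 : mulCyc (ind11 0) (ind11 3) = addL (ind11 1) (ind11 2) := by decide +kernel

/-- `ind11 0 * ind11 4` (cyclic convolution modulo `11`). [folklore] -/
theorem ind11_check_04 : mulCyc (ind11 0) (ind11 4) = addL (ind11 4) (ind11 2) := by decide +kernel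

/-- `ind11 1 * ind11 0` (cyclic convolution modulo `11`). [folklore] -/
theorem ind11_check_10 : mulCyc (ind11 1) (ind11 0) = addL (ind11 3) (ind11 0) := by decide +kernel

/-- `ind11 1 * ind11 1`. [folklore] -/
theorem ind11_check_11 : mulCyc (ind11 1) (ind11 1) = addL (ind11 2) (2 :: List.replicate 10 0) := by decide +kernel

/-- `ind11 1 * ind11 2` (cyclic convolution modulo `11`). [folklore] -/
theorem ind11_check_12 : mulCyc (ind11 1) (ind11 2) = addL (ind11 4) (ind11 1) := by decide +kernel

/-- `ind11 1 * ind11 3` (cyclic convolution modulo `11`). [folklore] -/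
theorem ind11_check_13 : mulCyc (ind11 1) (ind11 3) = addL (ind11 0) (ind11 4) := by decide +kernel

/-- `ind11 1 * ind11 4` (cyclic convolution modulo `11`). [folklore] -/
theorem ind11_check_14 : mulCyc (ind11 1) (ind11 4) = addL (ind11 2) (ind11 3) := by decide +kernel

/-- `ind11 2 * ind11 0` (cyclic convolution modulo `11`). [folklore] -/
theorem ind11_check_20 : mulCyc (ind11 2) (ind11 0) = addL (ind11 4) (ind11 3) := by decide +kernel

/-- `ind11 2 * ind11 1` (cyclic convolution modulo `11`). [folklore] -/
theorem ind11_check_21 : mulCyc (ind11 2) (ind11 1) = addL (ind11 4) (ind11 1) := by decide +kernel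

/-- `ind11 2 * ind11 2`. [folklore] -/
theorem ind11_check_22 : mulCyc (ind11 2) (ind11 2) = addL (ind11 3) (2 :: List.replicate 10 0) := by decide +kernel

/-- `ind11 2 * ind11 3` (cyclic convolution modulo `11`). [folklore] -/
theorem ind11_check_23 : mulCyc (ind11 2) (ind11 3) = addL (ind11 0) (ind11 2) := by decide +kernel

/-- `ind11 2 * ind11 4` (cyclic convolution modulo `11`). [folklore] -/
theorem ind11_check_24 : mulCyc (ind11 2) (ind11 4) = addL (ind11 1) (ind11 0) := by decide +kernel

/-- `ind11 3 * ind11 0` (cyclic convolution modulo `11`). [folklore] -/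
theorem ind11_check_30 : mulCyc (ind11 3) (ind11 0) = addL (ind11 1) (ind11 2) := by decide +kernel

/-- `ind11 3 * ind11 1` (cyclic convolution modulo `11`). [folklore] -/
theorem ind11_check_31 : mulCyc (ind11 3) (ind11 1) = addL (ind11 0) (ind11 4) := by decide +kernel

/-- `ind11 3 * ind11 2` (cyclic convolution modulo `11`). [folklore] -/
theorem ind11_check_32 : mulCyc (ind11 3) (ind11 2) = addL (ind11 0) (ind11 2) := by decide +kernel

/-- `ind11 3 * ind11 3`. [folklore] -/
theorem ind11_check_33 : mulCyc (ind11 3) (ind11 3) = addL (ind11 4) (2 :: List.replicate 10 0) := by decide +kernel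

/-- `ind11 3 * ind11 4` (cyclic convolution modulo `11`). [folklore] -/
theorem ind11_check_34 : mulCyc (ind11 3) (ind11 4) = addL (ind11 1) (ind11 3) := by decide +kernel

/-- `ind11 4 * ind11 0` (cyclic convolution modulo `11`). [folklore] -/
theorem ind11_check_40 : mulCyc (ind11 4) (ind11 0) = addL (ind11 4) (ind11 2) := by decide +kernel

/-- `ind11 4 * ind11 1` (cyclic convolution modulo `11`). [folklore] -/
theorem ind11_check_41 : mulCyc (ind11 4) (ind11 1) = addL (ind11 2) (ind11 3) := by decide +kernel

/-- `ind11 4 * ind11 2` (cyclic convolution modulo `11`). [folklore] -/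
theorem ind11_check_42 : mulCyc (ind11 4) (ind11 2) = addL (ind11 1) (ind11 0) := by decide +kernel

/-- `ind11 4 * ind11 3` (cyclic convolution modulo `11`). [folklore] -/
theorem ind11_check_43 : mulCyc (ind11 4) (ind11 3) = addL (ind11 1) (ind11 3) := by decide +kernel

/-- `ind11 4 * ind11 4`. [folklore] -/
theorem ind11_check_44 : mulCyc (ind11 4) (ind11 4) = addL (ind11 0) (2 :: List.replicate 10 0) := by decide +kernel


section Sys11

variable {R : Type*} [CommRing R] (ω : R)

/-- `eval (ind11 a) = ω^{2ᵃ} + ω^{11-2ᵃ}`. [folklore] -/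
theorem evalCyc_ind11 (a : Fin 5) : evalCyc ω (ind11 a) = ω ^ ex11 a + ω ^ (11 - ex11 a) := by
  fin_cases a <;> simp [ind11, ex11, evalCyc, List.range, List.range.loop] <;> ring

end Sys11

/-- **The `11`-periods are a system for `spec11T`.** [folklore] -/
theorem isSystem11 : spec11T.IsSystem (η11 K) := by
  have hζ : ζ11 K ^ 11 = 1 := ζ11_pow_eleven K
  have hS : ∑ k ∈ range 11, ζ11 K ^ k = 0 := (isPrimitiveRoot_ζ11 K).geom_sum_eq_zero (by norm_num)
  have hsum : η11 K 0 + η11 K 1 + η11 K 2 + η11 K 3 + η11 K 4 = -1 := by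
    simp only [η11, ex11, Matrix.cons_val_zero, Matrix.cons_val_one, Matrix.head_cons, Matrix.cons_val_two, Matrix.tail_cons,
      Matrix.cons_val_three, Matrix.cons_val_four]
    simp only [Finset.sum_range_succ, Finset.sum_range_zero, pow_zero] at hS
    linear_combination hS
  have hev : ∀ a, η11 K a = evalCyc (ζ11 K) (ind11 a) := fun a => (evalCyc_ind11 _ a).symm
  have hne : ∀ a, ind11 a ≠ [] := by decide
  have hlen : ∀ a, (ind11 a).length = 11 := by decide
  have hωl : ∀ a, ζ11 K ^ (ind11 a).length = 1 := fun a => by rw [hlen]; exact hζ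
  have hprod : ∀ a b, η11 K a * η11 K b = evalCyc (ζ11 K) (mulCyc (ind11 a) (ind11 b)) := fun a b => by
    rw [evalCyc_mulCyc _ _ (hne b) (hωl b), hev, hev]
  have hadd : ∀ a b : Fin 5, evalCyc (ζ11 K) (addL (ind11 a) (ind11 b)) = η11 K a + η11 K b := fun a b => by
    rw [evalCyc_addL _ _ _ (by rw [hlen, hlen]), hev, hev]
  have hadd2 : ∀ a : Fin 5, evalCyc (ζ11 K) (addL (ind11 a) (2 :: List.replicate 10 0)) = η11 K a + 2 := fun a => by
    rw [evalCyc_addL _ _ _ (by rw [hlen]; rfl), hev, evalCyc_cons_replicate_zero]; push_cast; ring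
  refine ⟨fun a b => ?_, ?_⟩
  · rw [Fin.sum_univ_five]
    fin_cases a <;> fin_cases b <;>
      simp only [spec11T, Fin.zero_eta, Fin.mk_one, Fin.isValue, Fin.reduceFinMk, Matrix.cons_val_zero, Matrix.cons_val_one,
        Matrix.head_cons, Matrix.cons_val_two, Matrix.tail_cons, Matrix.cons_val_three, Matrix.cons_val_four,
        Int.cast_ofNat, Int.cast_neg, Int.cast_one] <;>
      first
        | (linear_combination (hprod 0 0).trans ((congrArg (evalCyc (ζ11 K)) ind11_check_00).trans (hadd2 1)) + (2 : K) * hsum)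
        | (linear_combination (hprod 0 1).trans ((congrArg (evalCyc (ζ11 K)) ind11_check_01).trans (hadd 3 0)))
        | (linear_combination (hprod 0 2).trans ((congrArg (evalCyc (ζ11 K)) ind11_check_02).trans (hadd 4 3)))
        | (linear_combination (hprod 0 3).trans ((congrArg (evalCyc (ζ11 K)) ind11_check_03).trans (hadd 1 2)))
        | (linear_combination (hprod 0 4).trans ((congrArg (evalCyc (ζ11 K)) ind11_check_04).trans (hadd 4 2)))
        | (linear_combination (hprod 1 0).trans ((congrArg (evalCyc (ζ11 K)) ind11_check_10).trans (hadd 3 0)))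
        | (linear_combination (hprod 1 1).trans ((congrArg (evalCyc (ζ11 K)) ind11_check_11).trans (hadd2 2)) + (2 : K) * hsum)
        | (linear_combination (hprod 1 2).trans ((congrArg (evalCyc (ζ11 K)) ind11_check_12).trans (hadd 4 1)))
        | (linear_combination (hprod 1 3).trans ((congrArg (evalCyc (ζ11 K)) ind11_check_13).trans (hadd 0 4)))
        | (linear_combination (hprod 1 4).trans ((congrArg (evalCyc (ζ11 K)) ind11_check_14).trans (hadd 2 3)))
        | (linear_combination (hprod 2 0).trans ((congrArg (evalCyc (ζ11 K)) ind11_check_20).trans (hadd 4 3)))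
        | (linear_combination (hprod 2 1).trans ((congrArg (evalCyc (ζ11 K)) ind11_check_21).trans (hadd 4 1)))
        | (linear_combination (hprod 2 2).trans ((congrArg (evalCyc (ζ11 K)) ind11_check_22).trans (hadd2 3)) + (2 : K) * hsum)
        | (linear_combination (hprod 2 3).trans ((congrArg (evalCyc (ζ11 K)) ind11_check_23).trans (hadd 0 2)))
        | (linear_combination (hprod 2 4).trans ((congrArg (evalCyc (ζ11 K)) ind11_check_24).trans (hadd 1 0)))
        | (linear_combination (hprod 3 0).trans ((congrArg (evalCyc (ζ11 K)) ind11_check_30).trans (hadd 1 2)))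
        | (linear_combination (hprod 3 1).trans ((congrArg (evalCyc (ζ11 K)) ind11_check_31).trans (hadd 0 4)))
        | (linear_combination (hprod 3 2).trans ((congrArg (evalCyc (ζ11 K)) ind11_check_32).trans (hadd 0 2)))
        | (linear_combination (hprod 3 3).trans ((congrArg (evalCyc (ζ11 K)) ind11_check_33).trans (hadd2 4)) + (2 : K) * hsum)
        | (linear_combination (hprod 3 4).trans ((congrArg (evalCyc (ζ11 K)) ind11_check_34).trans (hadd 1 3)))
        | (linear_combination (hprod 4 0).trans ((congrArg (evalCyc (ζ11 K)) ind11_check_40).trans (hadd 4 2)))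
        | (linear_combination (hprod 4 1).trans ((congrArg (evalCyc (ζ11 K)) ind11_check_41).trans (hadd 2 3)))
        | (linear_combination (hprod 4 2).trans ((congrArg (evalCyc (ζ11 K)) ind11_check_42).trans (hadd 1 0)))
        | (linear_combination (hprod 4 3).trans ((congrArg (evalCyc (ζ11 K)) ind11_check_43).trans (hadd 1 3)))
        | (linear_combination (hprod 4 4).trans ((congrArg (evalCyc (ζ11 K)) ind11_check_44).trans (hadd2 0)) + (2 : K) * hsum)
  · rw [Fin.sum_univ_five]
    simp only [spec11T, Int.cast_neg, Int.cast_one]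
    linear_combination (-1 : K) * hsum

/-- **The `241`-periods are a system for `spec241T`.** [folklore] -/
theorem isSystem241 : spec241T.IsSystem (θ241c K) := by
  have hP := isPeriodSystem_gauss (ω241 K) (ω241_pow K) (geom_sum_ω241 K)
  change PeriodRing241.IsPeriodSystem (θ241c K) at hP
  refine ⟨fun a b => ?_, ?_⟩
  · fin_cases a <;> fin_cases b
    · show θ241c K 0 * θ241c K 0 = ∑ c, ((spec241T.T 0 0 c : ℤ) : K) * θ241c K c
      rw [hP.h00, Fin.sum_univ_five]
      simp only [spec241T, Fin.isValue, Matrix.cons_val_zero, Matrix.cons_val_one, Matrix.head_cons, Matrix.cons_val_two, Matrix.tail_cons,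
        Matrix.cons_val_three, Matrix.cons_val_four, Int.cast_ofNat, Int.cast_neg]
      linear_combination (48 : K) * hP.sum_eq
    · show θ241c K 0 * θ241c K 1 = ∑ c, ((spec241T.T 0 1 c : ℤ) : K) * θ241c K c
      rw [hP.h01, Fin.sum_univ_five]
      simp only [spec241T, Fin.isValue, Matrix.cons_val_zero, Matrix.cons_val_one, Matrix.head_cons, Matrix.cons_val_two, Matrix.tail_cons,
        Matrix.cons_val_three, Matrix.cons_val_four, Int.cast_ofNat]
    · show θ241c K 0 * θ241c K 2 = ∑ c, ((spec241T.T 0 2 c : ℤ) : K) * θ241c K c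
      rw [hP.h02, Fin.sum_univ_five]
      simp only [spec241T, Fin.isValue, Matrix.cons_val_zero, Matrix.cons_val_one, Matrix.head_cons, Matrix.cons_val_two, Matrix.tail_cons,
        Matrix.cons_val_three, Matrix.cons_val_four, Int.cast_ofNat]
    · show θ241c K 0 * θ241c K 3 = ∑ c, ((spec241T.T 0 3 c : ℤ) : K) * θ241c K c
      rw [hP.h03, Fin.sum_univ_five]
      simp only [spec241T, Fin.isValue, Matrix.cons_val_zero, Matrix.cons_val_one, Matrix.head_cons, Matrix.cons_val_two, Matrix.tail_cons,
        Matrix.cons_val_three, Matrix.cons_val_four, Int.cast_ofNat]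
    · show θ241c K 0 * θ241c K 4 = ∑ c, ((spec241T.T 0 4 c : ℤ) : K) * θ241c K c
      rw [hP.h04, Fin.sum_univ_five]
      simp only [spec241T, Fin.isValue, Matrix.cons_val_zero, Matrix.cons_val_one, Matrix.head_cons, Matrix.cons_val_two, Matrix.tail_cons,
        Matrix.cons_val_three, Matrix.cons_val_four, Int.cast_ofNat]
    · show θ241c K 1 * θ241c K 0 = ∑ c, ((spec241T.T 1 0 c : ℤ) : K) * θ241c K c
      rw [mul_comm]
      rw [hP.h01, Fin.sum_univ_five]
      simp only [spec241T, Fin.isValue, Matrix.cons_val_zero, Matrix.cons_val_one, Matrix.head_cons, Matrix.cons_val_two, Matrix.tail_cons,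
        Matrix.cons_val_three, Matrix.cons_val_four, Int.cast_ofNat]
    · show θ241c K 1 * θ241c K 1 = ∑ c, ((spec241T.T 1 1 c : ℤ) : K) * θ241c K c
      rw [hP.h11, Fin.sum_univ_five]
      simp only [spec241T, Fin.isValue, Matrix.cons_val_zero, Matrix.cons_val_one, Matrix.head_cons, Matrix.cons_val_two, Matrix.tail_cons,
        Matrix.cons_val_three, Matrix.cons_val_four, Int.cast_ofNat, Int.cast_neg]
      linear_combination (48 : K) * hP.sum_eq
    · show θ241c K 1 * θ241c K 2 = ∑ c, ((spec241T.T 1 2 c : ℤ) : K) * θ241c K c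
      rw [hP.h12, Fin.sum_univ_five]
      simp only [spec241T, Fin.isValue, Matrix.cons_val_zero, Matrix.cons_val_one, Matrix.head_cons, Matrix.cons_val_two, Matrix.tail_cons,
        Matrix.cons_val_three, Matrix.cons_val_four, Int.cast_ofNat]
    · show θ241c K 1 * θ241c K 3 = ∑ c, ((spec241T.T 1 3 c : ℤ) : K) * θ241c K c
      rw [hP.h13, Fin.sum_univ_five]
      simp only [spec241T, Fin.isValue, Matrix.cons_val_zero, Matrix.cons_val_one, Matrix.head_cons, Matrix.cons_val_two, Matrix.tail_cons,
        Matrix.cons_val_three, Matrix.cons_val_four, Int.cast_ofNat]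
    · show θ241c K 1 * θ241c K 4 = ∑ c, ((spec241T.T 1 4 c : ℤ) : K) * θ241c K c
      rw [hP.h14, Fin.sum_univ_five]
      simp only [spec241T, Fin.isValue, Matrix.cons_val_zero, Matrix.cons_val_one, Matrix.head_cons, Matrix.cons_val_two, Matrix.tail_cons,
        Matrix.cons_val_three, Matrix.cons_val_four, Int.cast_ofNat]
    · show θ241c K 2 * θ241c K 0 = ∑ c, ((spec241T.T 2 0 c : ℤ) : K) * θ241c K c
      rw [mul_comm]
      rw [hP.h02, Fin.sum_univ_five]
      simp only [spec241T, Fin.isValue, Matrix.cons_val_zero, Matrix.cons_val_one, Matrix.head_cons, Matrix.cons_val_two, Matrix.tail_cons,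
        Matrix.cons_val_three, Matrix.cons_val_four, Int.cast_ofNat]
    · show θ241c K 2 * θ241c K 1 = ∑ c, ((spec241T.T 2 1 c : ℤ) : K) * θ241c K c
      rw [mul_comm]
      rw [hP.h12, Fin.sum_univ_five]
      simp only [spec241T, Fin.isValue, Matrix.cons_val_zero, Matrix.cons_val_one, Matrix.head_cons, Matrix.cons_val_two, Matrix.tail_cons,
        Matrix.cons_val_three, Matrix.cons_val_four, Int.cast_ofNat]
    · show θ241c K 2 * θ241c K 2 = ∑ c, ((spec241T.T 2 2 c : ℤ) : K) * θ241c K c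
      rw [hP.h22, Fin.sum_univ_five]
      simp only [spec241T, Fin.isValue, Matrix.cons_val_zero, Matrix.cons_val_one, Matrix.head_cons, Matrix.cons_val_two, Matrix.tail_cons,
        Matrix.cons_val_three, Matrix.cons_val_four, Int.cast_ofNat, Int.cast_neg]
      linear_combination (48 : K) * hP.sum_eq
    · show θ241c K 2 * θ241c K 3 = ∑ c, ((spec241T.T 2 3 c : ℤ) : K) * θ241c K c
      rw [hP.h23, Fin.sum_univ_five]
      simp only [spec241T, Fin.isValue, Matrix.cons_val_zero, Matrix.cons_val_one, Matrix.head_cons, Matrix.cons_val_two, Matrix.tail_cons,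
        Matrix.cons_val_three, Matrix.cons_val_four, Int.cast_ofNat]
    · show θ241c K 2 * θ241c K 4 = ∑ c, ((spec241T.T 2 4 c : ℤ) : K) * θ241c K c
      rw [hP.h24, Fin.sum_univ_five]
      simp only [spec241T, Fin.isValue, Matrix.cons_val_zero, Matrix.cons_val_one, Matrix.head_cons, Matrix.cons_val_two, Matrix.tail_cons,
        Matrix.cons_val_three, Matrix.cons_val_four, Int.cast_ofNat]
    · show θ241c K 3 * θ241c K 0 = ∑ c, ((spec241T.T 3 0 c : ℤ) : K) * θ241c K c
      rw [mul_comm]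
      rw [hP.h03, Fin.sum_univ_five]
      simp only [spec241T, Fin.isValue, Matrix.cons_val_zero, Matrix.cons_val_one, Matrix.head_cons, Matrix.cons_val_two, Matrix.tail_cons,
        Matrix.cons_val_three, Matrix.cons_val_four, Int.cast_ofNat]
    · show θ241c K 3 * θ241c K 1 = ∑ c, ((spec241T.T 3 1 c : ℤ) : K) * θ241c K c
      rw [mul_comm]
      rw [hP.h13, Fin.sum_univ_five]
      simp only [spec241T, Fin.isValue, Matrix.cons_val_zero, Matrix.cons_val_one, Matrix.head_cons, Matrix.cons_val_two, Matrix.tail_cons,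
        Matrix.cons_val_three, Matrix.cons_val_four, Int.cast_ofNat]
    · show θ241c K 3 * θ241c K 2 = ∑ c, ((spec241T.T 3 2 c : ℤ) : K) * θ241c K c
      rw [mul_comm]
      rw [hP.h23, Fin.sum_univ_five]
      simp only [spec241T, Fin.isValue, Matrix.cons_val_zero, Matrix.cons_val_one, Matrix.head_cons, Matrix.cons_val_two, Matrix.tail_cons,
        Matrix.cons_val_three, Matrix.cons_val_four, Int.cast_ofNat]
    · show θ241c K 3 * θ241c K 3 = ∑ c, ((spec241T.T 3 3 c : ℤ) : K) * θ241c K c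
      rw [hP.h33, Fin.sum_univ_five]
      simp only [spec241T, Fin.isValue, Matrix.cons_val_zero, Matrix.cons_val_one, Matrix.head_cons, Matrix.cons_val_two, Matrix.tail_cons,
        Matrix.cons_val_three, Matrix.cons_val_four, Int.cast_ofNat, Int.cast_neg]
      linear_combination (48 : K) * hP.sum_eq
    · show θ241c K 3 * θ241c K 4 = ∑ c, ((spec241T.T 3 4 c : ℤ) : K) * θ241c K c
      rw [hP.h34, Fin.sum_univ_five]
      simp only [spec241T, Fin.isValue, Matrix.cons_val_zero, Matrix.cons_val_one, Matrix.head_cons, Matrix.cons_val_two, Matrix.tail_cons,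
        Matrix.cons_val_three, Matrix.cons_val_four, Int.cast_ofNat]
    · show θ241c K 4 * θ241c K 0 = ∑ c, ((spec241T.T 4 0 c : ℤ) : K) * θ241c K c
      rw [mul_comm]
      rw [hP.h04, Fin.sum_univ_five]
      simp only [spec241T, Fin.isValue, Matrix.cons_val_zero, Matrix.cons_val_one, Matrix.head_cons, Matrix.cons_val_two, Matrix.tail_cons,
        Matrix.cons_val_three, Matrix.cons_val_four, Int.cast_ofNat]
    · show θ241c K 4 * θ241c K 1 = ∑ c, ((spec241T.T 4 1 c : ℤ) : K) * θ241c K c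
      rw [mul_comm]
      rw [hP.h14, Fin.sum_univ_five]
      simp only [spec241T, Fin.isValue, Matrix.cons_val_zero, Matrix.cons_val_one, Matrix.head_cons, Matrix.cons_val_two, Matrix.tail_cons,
        Matrix.cons_val_three, Matrix.cons_val_four, Int.cast_ofNat]
    · show θ241c K 4 * θ241c K 2 = ∑ c, ((spec241T.T 4 2 c : ℤ) : K) * θ241c K c
      rw [mul_comm]
      rw [hP.h24, Fin.sum_univ_five]
      simp only [spec241T, Fin.isValue, Matrix.cons_val_zero, Matrix.cons_val_one, Matrix.head_cons, Matrix.cons_val_two, Matrix.tail_cons,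
        Matrix.cons_val_three, Matrix.cons_val_four, Int.cast_ofNat]
    · show θ241c K 4 * θ241c K 3 = ∑ c, ((spec241T.T 4 3 c : ℤ) : K) * θ241c K c
      rw [mul_comm]
      rw [hP.h34, Fin.sum_univ_five]
      simp only [spec241T, Fin.isValue, Matrix.cons_val_zero, Matrix.cons_val_one, Matrix.head_cons, Matrix.cons_val_two, Matrix.tail_cons,
        Matrix.cons_val_three, Matrix.cons_val_four, Int.cast_ofNat]
    · show θ241c K 4 * θ241c K 4 = ∑ c, ((spec241T.T 4 4 c : ℤ) : K) * θ241c K c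
      rw [hP.h44, Fin.sum_univ_five]
      simp only [spec241T, Fin.isValue, Matrix.cons_val_zero, Matrix.cons_val_one, Matrix.head_cons, Matrix.cons_val_two, Matrix.tail_cons,
        Matrix.cons_val_three, Matrix.cons_val_four, Int.cast_ofNat, Int.cast_neg]
      linear_combination (48 : K) * hP.sum_eq
  · rw [Fin.sum_univ_five]
    simp only [spec241T, Int.cast_neg, Int.cast_one]
    linear_combination (-1 : K) * hP.sum_eq

/-! ### The homomorphism `A → K` and the periods `θK_j` -/

/-- `ℤ[θ241] → K`. [folklore] -/
def φ241 : B241 →+* K := TableSpec.lift (isSystem241 K)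

/-- **`A = ℤ[η11] ⊗ ℤ[θ241] → K`.** [folklore] -/
def Φ : A25 →+* K := (TableSpec.liftA (R := K) (A := K) (isSystem11 K)).comp (TAlg.map (φ241 K))

/-- **The Gaussian period of `H_j`: `θK j = Σ_a η11_a θ241_{j a}`.** [folklore] -/
def θK (j : ℕ) : K := ∑ a : Fin 5, θ241c K ⟨j * (a : ℕ) % 5, Nat.mod_lt _ (by norm_num)⟩ * η11 K a

/-- `Φ p_j = θK j`. [folklore] -/
theorem Φ_pT (j : ℕ) : Φ K (pT j) = θK K j := by
  rw [Φ, RingHom.comp_apply, TableSpec.liftA_map, θK]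
  refine Finset.sum_congr rfl fun a _ => ?_
  rw [Algebra.algebraMap_self, RingHom.id_apply, show (pT j).coef a = TAlg.basis _ from rfl, φ241, TableSpec.lift_basis]

/-- **`f₁(θK 1) = 0`, …, `f₄(θK 4) = 0`.** [folklore] -/
theorem θK_rel :
    (θK K 1 ^ 5 - θK K 1 ^ 4 - 1060 * θK K 1 ^ 3 + 8165 * θK K 1 ^ 2 + 42925 * θK K 1 - 351649 = 0) ∧ (θK K 2 ^ 5 - θK K 2 ^ 4 - 1060 * θK K 2 ^ 3 - 18345 * θK K 2 ^ 2 - 105531 * θK K 2 - 192589 = 0) ∧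
    (θK K 3 ^ 5 - θK K 3 ^ 4 - 1060 * θK K 3 ^ 3 - 7741 * θK K 3 ^ 2 + 106549 * θK K 3 + 125531 = 0) ∧ (θK K 4 ^ 5 - θK K 4 ^ 4 - 1060 * θK K 4 ^ 3 + 18769 * θK K 4 ^ 2 - 105531 * θK K 4 + 178551 = 0) := by
  refine ⟨?_, ?_, ?_, ?_⟩
  · have h := congrArg (Φ K) pT_rel_1
    simp only [map_add, map_sub, map_mul, map_pow, map_ofNat, map_zero, Φ_pT] at h
    exact h
  · have h := congrArg (Φ K) pT_rel_2
    simp only [map_sub, map_mul, map_pow, map_ofNat, map_zero, Φ_pT] at h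
    exact h
  · have h := congrArg (Φ K) pT_rel_3
    simp only [map_add, map_sub, map_mul, map_pow, map_ofNat, map_zero, Φ_pT] at h
    exact h
  · have h := congrArg (Φ K) pT_rel_4
    simp only [map_add, map_sub, map_mul, map_pow, map_ofNat, map_zero, Φ_pT] at h
    exact h

/-! ### The Galois action on the conjugate periods -/

/-- `ζ = ζ₂₆₅₁`. [folklore] -/
def ζ2651 : K := IsCyclotomicExtension.zeta 2651 ℚ K

/-- `ζ²⁶⁵¹ = 1`. [folklore] -/
theorem ζ2651_pow : ζ2651 K ^ 2651 = 1 := (IsCyclotomicExtension.zeta_spec 2651 ℚ K).pow_eq_one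

/-- **The exponent `c` of `g ∈ Gal(K/ℚ)`**: `g ζ = ζᶜ`, `c < 2651` (Mathlib `galEquivZMod`). [folklore] -/
def galExp (g : Gal(K/ℚ)) : ℕ := (((IsCyclotomicExtension.Rat.galEquivZMod 2651 K) g : (ZMod 2651)ˣ) : ZMod 2651).val

/-- `galExp g < 2651`. [folklore] -/
theorem galExp_lt (g : Gal(K/ℚ)) : galExp K g < 2651 := ZMod.val_lt _

/-- `galExp g` is prime to `2651`. [folklore] -/
theorem galExp_coprime (g : Gal(K/ℚ)) : Nat.Coprime (galExp K g) 2651 := ZMod.val_coe_unit_coprime _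

set_option backward.isDefEq.respectTransparency false in
/-- **`g ζ = ζ^{galExp g}`.** [folklore] -/
theorem apply_ζ2651 (g : Gal(K/ℚ)) : g (ζ2651 K) = ζ2651 K ^ galExp K g :=
  IsCyclotomicExtension.Rat.galEquivZMod_apply_of_pow_eq 2651 K g (ζ2651_pow K)

set_option backward.isDefEq.respectTransparency false in
/-- `g ζ₁₁ = ζ₁₁ᶜ`. [folklore] -/
theorem apply_ζ11 (g : Gal(K/ℚ)) : g (ζ11 K) = ζ11 K ^ galExp K g := by
  rw [ζ11, map_pow, show IsCyclotomicExtension.zeta 2651 ℚ K = ζ2651 K from rfl, apply_ζ2651, ← pow_mul, ← pow_mul, mul_comm]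

set_option backward.isDefEq.respectTransparency false in
/-- `g ζ₂₄₁ = ζ₂₄₁ᶜ`. [folklore] -/
theorem apply_ω241 (g : Gal(K/ℚ)) : g (ω241 K) = ω241 K ^ galExp K g := by
  rw [ω241, map_pow, show IsCyclotomicExtension.zeta 2651 ℚ K = ζ2651 K from rfl, apply_ζ2651, ← pow_mul, ← pow_mul, mul_comm]

/-- **The shift `s(c)` on the `11`-periods**: `c · {±2ᵃ} = {±2^{a+s(c)}}` (`c` modulo `11`). [folklore] -/
def s11 (c : ℕ) : Fin 5 := (![0, 0, 1, 3, 2, 4, 4, 2, 3, 1, 0] : Fin 11 → Fin 5) ⟨c % 11, Nat.mod_lt _ (by norm_num)⟩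

/-- The exponent bookkeeping of `s11` (kernel check). [folklore] -/
theorem s11_spec : ∀ c < 11, c ≠ 0 → ∀ a : Fin 5,
    (c * ex11 a % 11 = ex11 (a + s11 c) ∧ c * (11 - ex11 a) % 11 = 11 - ex11 (a + s11 c)) ∨
    (c * ex11 a % 11 = 11 - ex11 (a + s11 c) ∧ c * (11 - ex11 a) % 11 = ex11 (a + s11 c)) := by
  decide

set_option backward.isDefEq.respectTransparency false in
/-- **`g (η11 a) = η11 (a + s(galExp g))`.** [folklore] -/
theorem apply_η11 (g : Gal(K/ℚ)) (a : Fin 5) : g (η11 K a) = η11 K (a + s11 (galExp K g)) := by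
  set c := galExp K g with hc
  have hmod : ∀ m : ℕ, ζ11 K ^ m = ζ11 K ^ (m % 11) := fun m => by
    conv_lhs => rw [← Nat.mod_add_div m 11, pow_add, pow_mul, ζ11_pow_eleven, one_pow, mul_one]
  have hc11 : c % 11 ≠ 0 := by
    intro h0
    have hdvd : 11 ∣ c := Nat.dvd_of_mod_eq_zero h0
    have := Nat.Coprime.coprime_dvd_left hdvd (galExp_coprime K g)
    norm_num at this
  have hs : s11 c = s11 (c % 11) := by simp [s11]
  have hx : ∀ a, ex11 a < 11 := by decide
  have hx' : ∀ a, 11 - ex11 a < 11 := by decide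
  have e1 : ∀ m, m < 11 → ζ11 K ^ (c * m) = ζ11 K ^ (c % 11 * m % 11) := fun m hm => by
    rw [hmod (c * m), Nat.mul_mod, Nat.mod_eq_of_lt hm]
  rw [η11, η11, map_add, map_pow, map_pow, apply_ζ11, ← pow_mul, ← pow_mul, e1 _ (hx a), e1 _ (hx' a), hs]
  rcases s11_spec (c % 11) (Nat.mod_lt _ (by norm_num)) hc11 a with ⟨h1, h2⟩ | ⟨h1, h2⟩
  · rw [h1, h2]
  · rw [h1, h2, add_comm]

/-! ### The Galois action on the `241`-periods: cosets as bit masks -/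

/-- **Bit masks of the five cosets of the fifth powers modulo `241`.** [folklore] -/
def m241 : Fin 5 → ℕ := ![2886824755836974112698920959002055420074494729043785157169289940177619222, 27849771564370604756982528092536708269992446475409582897012326967427200, 498220499350386100842348533525984619044773308888782609808102468681216072, 113883869741774420542222450623121150276232719709642877093070716238038048, 6915233063263420326120530242139133989474589633617689275736950520939008]

/-- The masks describe the indicator lists `ind241` (kernel check). [folklore] -/
theorem ind241_getD_eq : ∀ b : Fin 5, ∀ a < 241, (ind241 b).getD a 0 = if Nat.testBit (m241 b) a then 1 else 0 := by
  decide +kernel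

/-- **The coset index `t(c)` of `c` modulo `241`.** [folklore] -/
def t241 (c : ℕ) : Fin 5 :=
  if Nat.testBit (m241 1) (c % 241) then 1 else if Nat.testBit (m241 2) (c % 241) then 2
  else if Nat.testBit (m241 3) (c % 241) then 3 else if Nat.testBit (m241 4) (c % 241) then 4 else 0

/-- Kernel check: multiplication by `c` maps the coset `b` into the coset `b + t(c)`. [folklore] -/
theorem m241_perm_check : ((List.range 241).all fun c => (c == 0) || (List.finRange 5).all fun b =>
    (List.range 241).all fun a => !(Nat.testBit (m241 b) a) || Nat.testBit (m241 (b + t241 c)) (c * a % 241)) = true := by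
  decide +kernel

/-- **Multiplication by `c` maps the coset `b` onto the coset `b + t(c)`.** [folklore] -/
theorem m241_perm : ∀ c < 241, c ≠ 0 → ∀ b : Fin 5, ∀ a < 241,
    Nat.testBit (m241 b) a = true → Nat.testBit (m241 (b + t241 c)) (c * a % 241) = true := by
  intro c hc hc0 b a ha hba
  have h := m241_perm_check
  simp only [List.all_eq_true, List.mem_range, List.mem_finRange, Bool.or_eq_true, beq_iff_eq, Bool.not_eq_true',
    forall_const] at h
  rcases h c hc with h0 | h1
  · exact absurd h0 hc0
  · rcases h1 b a ha with h2 | h3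
    · rw [hba] at h2; exact absurd h2 (by decide)
    · exact h3

/-- The cosets as finsets of exponents. [folklore] -/
def C241 (b : Fin 5) : Finset ℕ := (range 241).filter fun a => Nat.testBit (m241 b) a = true

/-- Each coset has `48` elements (kernel count). [folklore] -/
theorem card_C241 : ∀ b : Fin 5, (C241 b).card = 48 := by decide +kernel

section Act241

variable {R : Type*} [CommRing R] (ω : R)

/-- `θ_b = Σ_{a ∈ C_b} ωᵃ`. [folklore] -/
theorem evalCyc_ind241_eq_sum_C (b : Fin 5) : evalCyc ω (ind241 b) = ∑ a ∈ C241 b, ω ^ a := by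
  rw [evalCyc_eq_sum, C241, Finset.sum_filter, length_ind241]
  refine Finset.sum_congr rfl fun a ha => ?_
  rw [ind241_getD_eq b a (Finset.mem_range.mp ha)]
  by_cases h : Nat.testBit (m241 b) a = true
  · rw [if_pos h, if_pos h, Nat.cast_one, one_mul]
  · rw [if_neg h, if_neg h, Nat.cast_zero, zero_mul]

/-- **Multiplication by `c` permutes the cosets**: `c · C_b = C_{b + t(c)}` for `0 < c < 241`. [folklore] -/
theorem image_C241 {c : ℕ} (hc : c < 241) (hc0 : c ≠ 0) (hcop : Nat.Coprime c 241) (b : Fin 5) :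
    (C241 b).image (fun a => c * a % 241) = C241 (b + t241 c) := by
  have hsub : (C241 b).image (fun a => c * a % 241) ⊆ C241 (b + t241 c) := by
    intro x hx
    rw [Finset.mem_image] at hx
    obtain ⟨a, ha, rfl⟩ := hx
    rw [C241, Finset.mem_filter] at ha ⊢
    exact ⟨Finset.mem_range.mpr (Nat.mod_lt _ (by norm_num)), m241_perm c hc hc0 b a (Finset.mem_range.mp ha.1) ha.2⟩
  refine Finset.eq_of_subset_of_card_le hsub ?_
  rw [Finset.card_image_of_injOn, card_C241, card_C241]
  exact fun a ha a' ha' h => injOn_pow_mul' hcop (Finset.mem_filter.mp ha).1 (Finset.mem_filter.mp ha').1 h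
where
  /-- multiplication by a unit is injective modulo `241` -/
  injOn_pow_mul' {c : ℕ} (hc : Nat.Coprime c 241) : Set.InjOn (fun a => c * a % 241) (range 241 : Finset ℕ) := by
    intro a ha a' ha' hab
    simp only [Finset.coe_range, Set.mem_Iio] at ha ha'
    have hmod : a ≡ a' [MOD 241] := Nat.ModEq.cancel_left_of_coprime (c := c) hc.symm hab
    rw [Nat.ModEq, Nat.mod_eq_of_lt ha, Nat.mod_eq_of_lt ha'] at hmod
    exact hmod

/-- **`Σ_{a ∈ C_b} ω^{c a} = Σ_{a ∈ C_{b+t(c)}} ωᵃ`** for `c` prime to `241`. [folklore] -/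
theorem sum_C241_mul (hω : ω ^ 241 = 1) {c : ℕ} (hcop : Nat.Coprime c 241) (b : Fin 5) :
    ∑ a ∈ C241 b, ω ^ (c * a) = ∑ a ∈ C241 (b + t241 c), ω ^ a := by
  have hmod : ∀ m : ℕ, ω ^ m = ω ^ (m % 241) := fun m => by
    conv_lhs => rw [← Nat.mod_add_div m 241, pow_add, pow_mul, hω, one_pow, mul_one]
  set c' := c % 241 with hc'
  have hc'lt : c' < 241 := Nat.mod_lt _ (by norm_num)
  have hc'0 : c' ≠ 0 := by
    intro h0
    have hdvd : 241 ∣ c := Nat.dvd_of_mod_eq_zero h0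
    have := Nat.Coprime.coprime_dvd_left hdvd hcop
    norm_num at this
  have hc'cop : Nat.Coprime c' 241 := by
    rw [hc', Nat.Coprime, ← Nat.gcd_rec]
    exact Nat.Coprime.symm hcop
  have ht : t241 c = t241 c' := by simp only [t241, hc', Nat.mod_mod]
  have himg := image_C241 hc'lt hc'0 hc'cop b
  have hexp : ∀ a, ω ^ (c * a) = ω ^ (c' * a % 241) := fun a => by
    rw [hmod (c * a)]
    congr 1
    rw [Nat.mul_mod, hc']
    conv_rhs => rw [Nat.mul_mod, Nat.mod_mod]
  have hinj : Set.InjOn (fun a => c' * a % 241) (C241 b) := fun a ha a' ha' h =>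
    image_C241.injOn_pow_mul' hc'cop (Finset.mem_filter.mp ha).1 (Finset.mem_filter.mp ha').1 h
  calc ∑ a ∈ C241 b, ω ^ (c * a) = ∑ a ∈ C241 b, ω ^ (c' * a % 241) := Finset.sum_congr rfl fun a _ => hexp a
    _ = ∑ x ∈ (C241 b).image (fun a => c' * a % 241), ω ^ x := (Finset.sum_image hinj).symm
    _ = ∑ a ∈ C241 (b + t241 c), ω ^ a := by rw [himg, ht]

end Act241

set_option backward.isDefEq.respectTransparency false in
/-- **`g (θ241c b) = θ241c (b + t(galExp g))`.** [folklore] -/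
theorem apply_θ241c (g : Gal(K/ℚ)) (b : Fin 5) : g (θ241c K b) = θ241c K (b + t241 (galExp K g)) := by
  have hcop : Nat.Coprime (galExp K g) 241 := (galExp_coprime K g).coprime_dvd_right (by norm_num)
  rw [θ241c, θ241c, map_evalCyc, apply_ω241, evalCyc_ind241_eq_sum_C, evalCyc_ind241_eq_sum_C]
  simp_rw [← pow_mul]
  exact sum_C241_mul _ (ω241_pow K) hcop b

/-! ### Invariance of `θK_j` and membership in `F₅` -/

set_option backward.isDefEq.respectTransparency false in
/-- **`g` fixes `θK j` as soon as `t(c) = j · s(c)`** (`c = galExp g`): reindex `a ↦ a + s`. [folklore] -/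
theorem apply_θK_eq (g : Gal(K/ℚ)) (j : ℕ)
    (h : t241 (galExp K g) = (⟨j % 5, Nat.mod_lt _ (by norm_num)⟩ : Fin 5) * s11 (galExp K g)) :
    g (θK K j) = θK K j := by
  have hidx : ∀ a : Fin 5, (⟨j * (a : ℕ) % 5, Nat.mod_lt _ (by norm_num)⟩ : Fin 5) =
      (⟨j % 5, Nat.mod_lt _ (by norm_num)⟩ : Fin 5) * a := fun a => by
    apply Fin.ext
    simp only [Fin.val_mul]
    rw [Nat.mul_mod]
    conv_rhs => rw [Nat.mul_mod, Nat.mod_mod]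
  rw [θK, map_sum]
  simp_rw [map_mul, apply_θ241c, apply_η11, hidx, h]
  exact Fintype.sum_equiv (Equiv.addRight (s11 (galExp K g))) _ _ fun a => by
    simp only [Equiv.coe_addRight, mul_add]

/-- Kernel check: fifth powers act trivially on both families of periods. [folklore] -/
theorem s11_t241_pow_five_check : ((List.range 2651).all fun b =>
    !(Nat.gcd b 2651 == 1) || ((s11 (b ^ 5 % 2651) == 0) && (t241 (b ^ 5 % 2651) == 0))) = true := by
  decide +kernel

/-- Fifth powers act trivially on both families of periods. [folklore] -/
theorem s11_t241_pow_five : ∀ b < 2651, Nat.Coprime b 2651 → s11 (b ^ 5 % 2651) = 0 ∧ t241 (b ^ 5 % 2651) = 0 := by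
  intro b hb hcop
  have h := s11_t241_pow_five_check
  simp only [List.all_eq_true, List.mem_range, Bool.or_eq_true, Bool.not_eq_true', Bool.and_eq_true, beq_iff_eq,
    beq_eq_false_iff_ne, ne_eq] at h
  rcases h b hb with h0 | h1
  · exact absurd hcop h0
  · exact h1

set_option backward.isDefEq.respectTransparency false in
/-- For `g` in the fifth powers, `galExp g = b⁵ mod 2651` for a unit `b`. [folklore] -/
theorem galExp_of_mem_galFifthPowers {g : Gal(K/ℚ)} (hg : g ∈ galFifthPowers K) :
    ∃ b : ℕ, b < 2651 ∧ Nat.Coprime b 2651 ∧ b ^ 5 % 2651 = galExp K g := by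
  rw [galFifthPowers, Subgroup.mem_comap, MonoidHom.mem_range] at hg
  obtain ⟨b, hb⟩ := hg
  rw [powMonoidHom_apply] at hb
  refine ⟨((b : (ZMod 2651)ˣ) : ZMod 2651).val, ZMod.val_lt _, ZMod.val_coe_unit_coprime b, ?_⟩
  have e : ((IsCyclotomicExtension.Rat.galEquivZMod 2651 K) g : (ZMod 2651)ˣ) = b ^ 5 := by rw [hb]; rfl
  symm
  rw [galExp, e, Units.val_pow_eq_pow_val, ← ZMod.natCast_zmod_val ((b : (ZMod 2651)ˣ) : ZMod 2651),
    ← Nat.cast_pow, ZMod.val_natCast, ZMod.val_natCast, Nat.mod_eq_of_lt (ZMod.val_lt ((b : (ZMod 2651)ˣ) : ZMod 2651))]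

set_option backward.isDefEq.respectTransparency false in
/-- **`θK j ∈ F₅`.** [folklore] -/
theorem θK_mem_F5 (j : ℕ) : θK K j ∈ F5 K := by
  rw [F5, IntermediateField.mem_fixedField_iff]
  intro g hg
  obtain ⟨b, hb, hbcop, hbc⟩ := galExp_of_mem_galFifthPowers K hg
  obtain ⟨hs, ht⟩ := s11_t241_pow_five b hb hbcop
  rw [hbc] at hs ht
  refine apply_θK_eq K g j ?_
  rw [hs, ht, mul_zero]

/-- **`θK j` as an element of `F₅`.** [folklore] -/
def θKF (j : ℕ) : F5 K := ⟨θK K j, θK_mem_F5 K j⟩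

/-- The period equations in `F₅`. [folklore] -/
theorem θKF_rel :
    (θKF K 1 ^ 5 - θKF K 1 ^ 4 - 1060 * θKF K 1 ^ 3 + 8165 * θKF K 1 ^ 2 + 42925 * θKF K 1 - 351649 = 0) ∧ (θKF K 2 ^ 5 - θKF K 2 ^ 4 - 1060 * θKF K 2 ^ 3 - 18345 * θKF K 2 ^ 2 - 105531 * θKF K 2 - 192589 = 0) ∧
    (θKF K 3 ^ 5 - θKF K 3 ^ 4 - 1060 * θKF K 3 ^ 3 - 7741 * θKF K 3 ^ 2 + 106549 * θKF K 3 + 125531 = 0) ∧ (θKF K 4 ^ 5 - θKF K 4 ^ 4 - 1060 * θKF K 4 ^ 3 + 18769 * θKF K 4 ^ 2 - 105531 * θKF K 4 + 178551 = 0) := by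
  refine ⟨?_, ?_, ?_, ?_⟩
  · apply (algebraMap (F5 K) K).injective
    simp only [map_add, map_sub, map_mul, map_pow, map_ofNat, map_zero]
    exact (θK_rel K).1
  · apply (algebraMap (F5 K) K).injective
    simp only [map_sub, map_mul, map_pow, map_ofNat, map_zero]
    exact (θK_rel K).2.1
  · apply (algebraMap (F5 K) K).injective
    simp only [map_add, map_sub, map_mul, map_pow, map_ofNat, map_zero]
    exact (θK_rel K).2.2.1
  · apply (algebraMap (F5 K) K).injective
    simp only [map_add, map_sub, map_mul, map_pow, map_ofNat, map_zero]
    exact (θK_rel K).2.2.2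

end DokchitserDokchitser2011

end Literature.Barriers.BirchSwinnertonDyer

end
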